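import Mathlib
import Summits.Ventures.PercRepro2.TypedUncrossed
import Summits.Ventures.PercRepro2.TypedPocketZero

/-!
# Pocket classes II: the mark pocket is uncrossed (blind cell PercRepro2, p3 g3, 2026-08-25;
`proofs/P3-BRIDGE.md` §11.18)

`o, b, a₃` on one side of an unmarked cut vertex `c`, both roots on the other: a mark at `a₁` and
a mark at `a₂` put both roots at `c` (`conn_cross`), hence `a₁ ↔ a₂` (`conn_side`) — the instance
is uncrossed (`UncrossedInst.of_pocket`) and every typed base is nonnegative
(`typedCount_nonneg_of_pocket`, from `TypedUncrossed.lean`); the pointwise form of the cut-roots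
theorem's placement.  Own work; standard axioms.
-/

namespace Summit.Ventures.PercRepro2

open UnionCluster

namespace CovForm

namespace RootBridge

open OneTyped TypedA3 Untouched TypedFactor Separated

section Pockets

open Classical

variable {V : Type*} {E : Type*} [Fintype E] [DecidableEq E] {R : Type*} [Field R]
  [LinearOrder R] [IsStrictOrderedRing R]
variable (ends : E → Sym2 V) (o a₁ a₂ a₃ b c : V)

omit [Fintype E] in
/-- **The mark pocket is uncrossed**: with `o, b, a₃ ∈ VL`, `a₁, a₂ ∈ VH`, `VL ∩ VH = {c}` and
every edge of `z ∪ F` inside a side, a mark at `a₁` and a mark at `a₂` force `a₁ ↔ a₂`. -/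
theorem UncrossedInst.of_pocket {VL VH : Set V} {F : Finset E} {z : Config E}
    (hsplit : ∀ e, zF F z e = true → e ∈ within ends VL ∨ e ∈ within ends VH)
    (hcap : ∀ t, t ∈ VL → t ∈ VH → t = c) (hcL : c ∈ VL) (hcH : c ∈ VH) (hoL : o ∈ VL)
    (hbL : b ∈ VL) (ha3L : a₃ ∈ VL) (ha1H : a₁ ∈ VH) (ha2H : a₂ ∈ VH) (hoc : o ≠ c) (hbc : b ≠ c)
    (ha3c : a₃ ≠ c) : UncrossedInst ends o a₁ a₂ a₃ b F z := by
  refine ⟨fun x hx hcr => ?_⟩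
  have hsp : ∀ e, x e = true → e ∈ within ends VH ∨ e ∈ within ends VL := fun e he =>
    (split_of_le_zF ends hsplit hx e he).symm
  have hcap' : ∀ t, t ∈ VH → t ∈ VL → t = c := fun t h1 h2 => hcap t h2 h1
  -- a mark at a root puts the root at `c` (inside `VH`)
  have toC : ∀ {r : V}, r ∈ VH → ∀ {u : V}, u ∈ VL → u ≠ c → Conn ends x r u →
      Conn ends (withinRestr ends VH x) r c := fun {r} hr {u} hu huc h =>
    ((conn_cross ends hsp hcap' ⟨hcH, hcL⟩ hr hu huc).mp h).1
  have h1 : Conn ends (withinRestr ends VH x) a₁ c := by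
    rcases hcr.atA1 with h | h | h
    · exact toC ha1H hoL hoc h
    · exact toC ha1H hbL hbc h
    · exact toC ha1H ha3L ha3c h
  have h2 : Conn ends (withinRestr ends VH x) a₂ c := by
    rcases hcr.atA2 with h | h | h
    · exact toC ha2H hoL hoc h
    · exact toC ha2H hbL hbc h
    · exact toC ha2H ha3L ha3c h
  have h12 : Conn ends (withinRestr ends VH x) a₂ a₁ := conn_trans h2 (conn_symm h1)
  exact hcr.notQ ((conn_side ends hsp hcap' ha2H ha1H).mpr h12)

/-- **Row 2′TRI on the mark pocket**: `o, b, a₃` behind an unmarked cut vertex, both roots on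
the other side — every typed base is nonnegative. -/
theorem typedCount_nonneg_of_pocket {VL VH : Set V} (F : Finset E) (z : Config E) (τ : E → ℕ)
    (hτ : ∀ e ∈ F, τ e = 1 ∨ τ e = 2)
    (hsplit : ∀ e, zF F z e = true → e ∈ within ends VL ∨ e ∈ within ends VH)
    (hcap : ∀ t, t ∈ VL → t ∈ VH → t = c) (hcL : c ∈ VL) (hcH : c ∈ VH) (hoL : o ∈ VL)
    (hbL : b ∈ VL) (ha3L : a₃ ∈ VL) (ha1H : a₁ ∈ VH) (ha2H : a₂ ∈ VH) (hoc : o ≠ c) (hbc : b ≠ c)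
    (ha3c : a₃ ≠ c) :
    0 ≤ typedCount F z τ (K3 ends o a₁ a₂ a₃ b : Config E → Config E → Config E → R) :=
  typedCount_nonneg_of_uncrossed ends o a₁ a₂ a₃ b F z τ hτ
    (UncrossedInst.of_pocket ends o a₁ a₂ a₃ b c hsplit hcap hcL hcH hoL hbL ha3L ha1H ha2H hoc hbc
      ha3c)

end Pockets


end RootBridge

end CovForm

end Summit.Ventures.PercRepro2
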